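import Summits.KontsevichZagierPeriods.Zeta5Search.TwoTaleP15Measure
import Summits.KontsevichZagierPeriods.Zeta5Search.Denom.TwoTaleP15IntegralTHolds
import HarnessLib

/-!
# The two-tale point P15: the three derivations of `μ(ζ(2)) ≤ 5.0499`, by name

HONEST FRAMING: systematic search; no irrationality claim unless certified.  Nothing here concerns ζ(5).
ONE BOUND, THREE DERIVATIONS — not three bounds.  The sentence of record is the referee's (REFEREE.md R70.4,
released on `TwoTaleP15Measure.zetaTwo_exponent_le_P15`, p265746), with its caveats verbatim: the [Zu14]
inputs are the tree's own kernel-checked formalisations (the paper [cite: Zudilin2014ZetaTwo, Theorem 1] is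
cited for provenance); the human-readable proof (paper §M) must be written and refereed before prose claims;
`5.0499` is the constant as filed, not optimised; this is a measure bound for the known-irrational number π²,
not an irrationality proof.

This file adds NO new bound.  It records the two further derivations of the SAME
statement `ExponentLE (zetaValue 2) 5.0499 ∧ zetaTwo_irrationalityExponent_le` that the referee probed by name
(second referee R-2.134, referee Round 71 R71.3) after the capstone `TwoTaleP15Measure` (route W1) was written:
* the ♭ derivation (the ONE new declaration, `zetaTwo_exponent_le_P15_flat`): Zudilin's own second-tale
  normaliser `E_n D_{16n} D_{15n}`
  (`Denom.TwoTaleP15IntegralTHolds.integralTFlat_holds`, p265275: [Zu14, Prop. 3] at the partner + P1's slice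
  `p > 17n` + THEOREM W on the window `13n < p ≤ 17n`), one common prime class, tale-2 decay `DecayT 28.462`
  (`TwoTaleSecondTaleDecayHolds.decayT_holds_floor`, p264401);
* the TopWindow derivation (an `example` — one named theorem per proposition suffices): file 46's
  three-hypothesis endgame
  `Denom.TwoTaleP15TopWindow.zetaTwo_exponent_le_of_topWindowT` with all three inputs discharged by name
  (`decayT_holds_floor`, `Denom.TwoTaleP15Prop3.prop3T_holds` p264432, `Denom.TwoTaleP15Window.topWindowT_holds`
  p260615) — the ♭ derivation packaged through its own hypotheses.
The three derivations share the first-tale inputs, Whipple's `q̂ = −q` and the tale-2 decay chain; they differ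
only in the arithmetic closing (W1: normaliser `D_{17n}² E_n²`, eight common cells; ♭/TopWindow: Zudilin's
normaliser, one common cell).  Human-readable proofs: paper §M items (M11) (W1), (M12) (tale-2 decay),
(M13) (♭).  Cell pub-zeta5, fam-denom g10 (staged for the filing lane); T3 service.
-/

namespace Summit.KontsevichZagierPeriods.Zeta5Search.TwoTaleP15Measure

open Literature.NumberTheory.Irrationality.Zudilin2014
open Literature.NumberTheory.Transcendental (zetaValue)
open Summit.KontsevichZagierPeriods.Zeta5Search

/-- **The ♭ derivation** of `μ(ζ(2)) ≤ 5.0499` (and of the printed record statement as its corollary): Zudilin's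
normaliser `E_n D_{16n} D_{15n}` for the second tale is a tree theorem (`integralTFlat_holds`), so the flat
endgame needs only the tale-2 decay `DecayT 28.462`, which is `decayT_holds_floor`.  Same statement as route W1's
`zetaTwo_exponent_le_P15` ∧ `zetaTwo_irrationalityExponent_le_of_W1`; a second derivation, not a second bound.
[cite: Zudilin2014ZetaTwo, Theorem 1] -/
theorem zetaTwo_exponent_le_P15_flat :
    ExponentLE (zetaValue 2) 5.0499 ∧ zetaTwo_irrationalityExponent_le :=
  Denom.TwoTaleP15IntegralTHolds.zetaTwo_exponent_le_of_decayT
    TwoTaleSecondTaleDecayHolds.decayT_holds_floor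

/-- **The TopWindow derivation** (an `example`, not a second declaration of the same proposition): file 46's
endgame `zetaTwo_exponent_le_of_topWindowT (hDT) (h3) (hW)` with its three inputs discharged by name — tale-2 decay
(`decayT_holds_floor`), [Zu14, Prop. 3] at the partner (`prop3T_holds`) and THEOREM W (`topWindowT_holds`). -/
example : ExponentLE (zetaValue 2) 5.0499 ∧ zetaTwo_irrationalityExponent_le :=
  Denom.TwoTaleP15TopWindow.zetaTwo_exponent_le_of_topWindowT
    TwoTaleSecondTaleDecayHolds.decayT_holds_floor
    Denom.TwoTaleP15Prop3.prop3T_holds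
    Denom.TwoTaleP15Window.topWindowT_holds

/-- **Route W1** (the capstone's two theorems, p265746), for comparison: the same proposition a third time. -/
example : ExponentLE (zetaValue 2) 5.0499 ∧ zetaTwo_irrationalityExponent_le :=
  ⟨zetaTwo_exponent_le_P15, zetaTwo_irrationalityExponent_le_of_W1⟩

/-- Mathlib-only reading of the ♭ derivation's first conjunct (as the referee's R70.3 (c) restatement):
for every real `p > 5.0499`, `π²/6` is not Liouville with exponent `p`. -/
example : ∀ p : ℝ, (5.0499 : ℝ) < p → ¬ LiouvilleWith p (Real.pi ^ 2 / 6) := by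
  intro p hp
  have h2 : zetaValue 2 = Real.pi ^ 2 / 6 := by rw [zetaValue]; exact hasSum_zeta_two.tsum_eq
  rw [← h2]
  exact zetaTwo_exponent_le_P15_flat.1 p hp

end Summit.KontsevichZagierPeriods.Zeta5Search.TwoTaleP15Measure
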